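import Literature.AnabelianGeometry.SemiGraphs.ProSigmaCompletionExtend
import Mathlib.GroupTheory.FreeGroup.NielsenSchreier
import HarnessLib

/-!
# Pro-`Σ` completions of discrete groups, III: open subgroups, and lifting for free `Γ`

Continuation of `ProSigmaCompletionQuotients.lean` / `ProSigmaCompletionExtend.lean` over
abc-iut-L3-t1's interface `SemiGraphOfAnabelioids.IsProSigmaCompletion Sigma ι` ([SemiAnbd] Example
2.10, "the maximal pro-`Σ` quotient of the fundamental group of a hyperbolic Riemann surface", p. 31)
[cite: MochizukiSemiAnbd2006, Ex. 2.10 p.31].  Theorems only: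

* `restrict_isOpen`: if `ι : Γ → P` is a pro-`Σ` completion (`P` profinite) and `W ⊆ P` is an open
  subgroup, then `ι : ι⁻¹(W) → W` is again a pro-`Σ` completion (density inside `W`; `Σ`-indices; and a
  normal `Σ`-index subgroup `K` of `ι⁻¹(W)` is cut out by the open subgroup `V · ι(K) ∩ W` for the open
  normal `V ⊴ P` of part II);
* `exists_lift_of_isOpen` — **open subgroups of the pro-`Σ` completion of a FREE group weakly solve
  finite `Σ`-embedding problems**: for `Γ` free (`IsFreeGroup`, any rank), `U ⊆ P` open, a surjection
  `α : B ↠ B̄` from a finite group of `Σ`-integer order and a continuous `ψ : U → B̄`, there is a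
  homomorphism `θ : U → B` with `α ∘ θ = ψ` (Nielsen–Schreier on `ι⁻¹(U)`, lift generator-wise, extend
  continuously by part II, compare on the dense image).  This is the pro-`Σ` analogue of
  abc-iut-L5-t17's `ProfiniteCompletion.exists_lift_of_isOpen` ([IUTchI] Lemma 2.7 (v) engine, the
  elementary stand-in for "cohomological dimension `≤ 1`").

No statement here takes a side on [IUTchIII] Cor. 3.12; this is plain (pro)finite group theory.
-/

namespace Literature.AnabelianGeometry.SemiGraphs.SemiGraphOfAnabelioids.IsProSigmaCompletion

open Literature.AnabelianGeometry.Anabelioids Topology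

variable {Sigma : Set ℕ} {Γ : Type*} [Group Γ] {P : Type*} [Group P] [TopologicalSpace P]
  {ι : Γ →* P}

section Profinite

variable [IsTopologicalGroup P] [CompactSpace P] [TotallyDisconnectedSpace P]

/-- **Open subgroups of pro-`Σ` completions are pro-`Σ` completions**: for `W ⊆ P` open (`P`
profinite), `ι : ι⁻¹(W) → W` satisfies `IsProSigmaCompletion Sigma`.
[cite: MochizukiSemiAnbd2006, Ex. 2.10 p.31] -/
theorem restrict_isOpen (hι : IsProSigmaCompletion Sigma ι) (W : Subgroup P)
    (hW : IsOpen (W : Set P)) :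
    IsProSigmaCompletion Sigma ((ι.comp (W.comap ι).subtype).codRestrict W fun x => x.2) := by
  classical
  refine ⟨?_, ?_, ?_⟩
  · -- density of `ι(ι⁻¹ W)` in `W`
    intro x
    rw [IsInducing.subtypeVal.closure_eq_preimage_closure_image, Set.mem_preimage]
    refine closure_mono ?_ (le_closure_image_comap hι W hW x.2)
    rintro _ ⟨γ, hγ, rfl⟩
    exact ⟨⟨ι γ, hγ⟩, ⟨⟨γ, hγ⟩, rfl⟩, rfl⟩
  · -- open normal subgroups of `W` have `Σ`-index
    intro N _ hN
    have hNP : IsOpen ((N.map W.subtype : Subgroup P) : Set P) := by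
      rw [Subgroup.coe_map]
      exact hW.isOpenMap_subtype_val _ hN
    have h := isSigmaInteger_index hι (N.map W.subtype) hNP
    rw [Subgroup.index_map_subtype] at h
    exact h.of_dvd (dvd_mul_right _ _)
  · -- a normal `Σ`-index `K ⊴ ι⁻¹(W)` is cut out by an open subgroup of `W`
    intro K hKn hK
    haveI : K.FiniteIndex := ⟨hK.1.ne'⟩
    have hcard : IsSigmaInteger Sigma (Nat.card (W.comap ι ⧸ K)) := by
      rwa [← Subgroup.index_eq_card]
    obtain ⟨V, hVo, hVn, hVU, hVf⟩ :=
      exists_open_normal_comap_le_ker hι W hW hcard (QuotientGroup.mk' K)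
    haveI := hVn
    -- `K` viewed in `P`
    let KP : Subgroup P := K.map (ι.comp (W.comap ι).subtype)
    refine ⟨(V ⊔ KP).subgroupOf W, ?_, ?_⟩
    · -- open: it contains the open subgroup `V ∩ W` of `W`
      refine Subgroup.isOpen_mono ?_ (Subgroup.subgroupOf_isOpen W V hVo)
      intro x hx
      exact Subgroup.mem_subgroupOf.mpr (Subgroup.mem_sup_left (Subgroup.mem_subgroupOf.mp hx))
    · ext γ
      rw [Subgroup.mem_comap, Subgroup.mem_subgroupOf]
      change (ι γ : P) ∈ V ⊔ KP ↔ γ ∈ K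
      constructor
      · intro h
        have h' : (ι γ : P) ∈ ((V ⊔ KP : Subgroup P) : Set P) := h
        rw [Subgroup.normal_mul] at h'
        obtain ⟨v, hv, _, ⟨κ, hκ, rfl⟩, hvk⟩ := h'
        -- `ι (γ κ⁻¹) = v ∈ V`, so `γ κ⁻¹ ∈ ι⁻¹(V) ⊆ Ker (ι⁻¹W → ι⁻¹W / K)`
        have hmem : ((γ * κ⁻¹ : W.comap ι) : Γ) ∈ V.comap ι := by
          rw [Subgroup.mem_comap]
          have : ι ((γ * κ⁻¹ : W.comap ι) : Γ) = v := by
            have e : v = ι (γ : Γ) * (ι (κ : Γ))⁻¹ := by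
              rw [← hvk]
              simp
            rw [e, Subgroup.coe_mul, Subgroup.coe_inv, map_mul, map_inv]
          rw [this]
          exact hv
        have h1 := hVf _ hmem
        have h2 : (QuotientGroup.mk' K) (γ * κ⁻¹) = 1 := by
          convert h1 using 2
        rw [QuotientGroup.mk'_apply, QuotientGroup.eq_one_iff] at h2
        have := K.mul_mem h2 hκ
        rwa [inv_mul_cancel_right] at this
      · intro h
        exact Subgroup.mem_sup_right ⟨γ, h, rfl⟩

/-! ### Finite `Σ`-embedding problems over open subgroups, `Γ` free -/

/-- **Lifting lemma (pro-`Σ`, free `Γ`).**  Let `Γ` be a free group, `ι : Γ → P` a pro-`Σ` completion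
with `P` profinite, `U ⊆ P` an open subgroup, `α : B ↠ B̄` a surjection from a finite group of
`Σ`-integer order onto a discrete group, and `ψ : U → B̄` a continuous homomorphism.  Then `ψ` lifts:
`α ∘ θ = ψ` for some homomorphism `θ : U → B`.  (`ι⁻¹(U)` is free by Nielsen–Schreier; lift `ψ ∘ ι`
generator-wise to `θ₀ : ι⁻¹(U) → B`; extend `θ₀` continuously to `U` (part II); `α ∘ θ` and `ψ` are
continuous and agree on the dense `ι(ι⁻¹ U)`.)  The pro-`Σ` analogue of abc-iut-L5-t17's lifting lemma
for `Ĝ` ([IUTchI] Lemma 2.7 (v), the elementary "cd `≤ 1`"). [cite: MochizukiSemiAnbd2006, Ex. 2.10 p.31] -/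
theorem exists_lift_of_isOpen [IsFreeGroup Γ] (hι : IsProSigmaCompletion Sigma ι) (U : Subgroup P)
    (hU : IsOpen (U : Set P)) {B Bbar : Type*} [Group B] [Group Bbar] [Finite B]
    (hB : IsSigmaInteger Sigma (Nat.card B)) [TopologicalSpace Bbar] [DiscreteTopology Bbar]
    (α : B →* Bbar) (hα : Function.Surjective α) (ψ : U →* Bbar) (hψ : Continuous ψ) :
    ∃ θ : U →* B, ∀ x : U, α (θ x) = ψ x := by
  classical
  -- the discrete side: `H = ι⁻¹(U)` is free (Nielsen–Schreier)
  let H : Subgroup Γ := U.comap ι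
  let ιU : H →* U := (ι.comp H.subtype).codRestrict U fun h => h.2
  let ψH : H →* Bbar := ψ.comp ιU
  have hgen : ∀ a : IsFreeGroup.Generators H, ∃ b : B, α b = ψH (IsFreeGroup.of a) := fun a => hα _
  choose b hb using hgen
  let θ₀ : H →* B := IsFreeGroup.lift b
  have hθ₀ : ∀ h : H, α (θ₀ h) = ψH h := by
    intro h
    have := IsFreeGroup.ext_hom (f := α.comp θ₀) (g := ψH) fun a => by
      simp only [MonoidHom.comp_apply, θ₀, IsFreeGroup.lift_of, hb]
    exact DFunLike.congr_fun this h
  -- extend `θ₀` continuously to `U`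
  letI : TopologicalSpace B := ⊥
  haveI : DiscreteTopology B := ⟨rfl⟩
  obtain ⟨θ, hθc, hθ⟩ := exists_continuous_extend hι U hU hB θ₀
  refine ⟨θ, fun x => ?_⟩
  -- `α ∘ θ` and `ψ` are continuous and agree on `ι(ι⁻¹ U)`
  have hcont : Continuous fun x : U => α (θ x) := continuous_of_discreteTopology.comp hθc
  have heq := continuous_ext_on hι U hU hcont hψ fun γ hγ => by
    rw [hθ γ hγ, hθ₀]
    rfl
  exact congrFun heq x

end Profinite

end Literature.AnabelianGeometry.SemiGraphs.SemiGraphOfAnabelioids.IsProSigmaCompletion
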